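import Literature.Probability.Percolation.RussoFormula
import Literature.Probability.Percolation.TwoPointFunction
import Literature.Probability.Percolation.Crossings
import Literature.Probability.Percolation.TreeGraphBound
import Literature.Probability.Percolation.HalfSpaceBGN
import HarnessLib

/-!
# `EquilateralAntiFactorisation` (stmt-CriticalPhenomena-7800), line `Sketch` (cards
# `pivotal-deficit-flow` / `pivotal-thinning-flow`) — definitions of the Russo flow of the
# three-point log-ratio in a box

The objects the line posits (registered skeleton
`Cruxes/EquilateralAntiFactorisation/Lines/Sketch.lean`), in the vocabulary of
`Literature.Probability.Percolation` (`bondPercolation`, `openConn`, `openConnIn`, `pivotals`, `box`):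

* `mu q` — Bernoulli bond percolation on `ℤ³` at the real parameter `q` clamped to `[0,1]`
  (so that `q ↦ P_q(E)` is a function on `ℝ` and Russo's formula `russo_formula_holds` applies verbatim);
* `ptA r = a_r = (r,r,0)`, `ptB r = b_r = (r,0,r)` — two vertices of the equilateral lattice triangle
  `{0, a_r, b_r}` (all three sides have Euclidean length `r√2` and are lattice-congruent);
* `evA n r = {0 ↔ a_r in Λ_n}`, `evB n r = {0 ↔ b_r in Λ_n}`, `evC n r = {a_r ↔ b_r in Λ_n}`,
  `evT n r = evA ∩ evB` — the pair / triple connection events inside the box `Λ_n = [-n,n]³`;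
* `pivInt E q = E_q[N_E]` — expected number of lattice edges pivotal for `E` (Russo's derivative),
  `pivCount E ω = N_E(ω)`;
* `flowIntegrand n r q = g_{n,r}(q) = 2 E_q[N_T]/P_q(T) − E_q[N_A]/P_q(A) − E_q[N_B]/P_q(B) − E_q[N_C]/P_q(C)`
  — the `q`-derivative of the box log-ratio
  `boxLogRatio n r q = F_{n,r}(q) = 2 log P_q(T) − log P_q(A) − log P_q(B) − log P_q(C)`;
* `infLogRatio r q = log R_r(q)²` — the same log-ratio for the infinite-volume events
  (`R_r(q)² = P_q(0 ↔ a_r ↔ b_r)² / (τ_q(0,a_r) τ_q(0,b_r) τ_q(a_r,b_r))`, the squared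
  Delfino–Viti / Gladkov three-point ratio of the crux).

Nothing here asserts anything about the crux; the flow identity, the box exhaustion and the
certificate `crux ⟺ window deficit` are proved in the sibling files
`PercTreeValueEquilateralAntiFactorisationFlow.lean` / `…FlowCertificate.lean`.
Sources: Russo 1981 §4 / Grimmett 1999 §2.4 (pivotal edges, Russo's formula); the ratio is that of
Delfino–Viti (doi:10.1088/1751-8113/44/3/032001) and Gladkov 2024 (arXiv:2408.08457, Thm 1.1).
-/

noncomputable section

open MeasureTheory
open Literature.Probability.Percolation Literature.Probability.LatticeModels

namespace Summit.CriticalPhenomena.PercolationContinuityZ3.Theorems.EquilateralAntiFactorisation.Flow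

/-- `P_q`: Bernoulli bond percolation on `ℤ³` at the real parameter `q`, clamped to `[0,1]`
(`projIcc`), so that parameter maps are functions on all of `ℝ`. [folklore] -/
def mu (q : ℝ) : Measure (BondConfig (Site 3)) :=
  bondPercolation (zdGraph 3) (Set.projIcc (0 : ℝ) 1 zero_le_one q)

/-- `P_q` is a probability measure (it is a `bondPercolation`). [folklore] -/
instance (q : ℝ) : IsProbabilityMeasure (mu q) := by
  unfold mu; infer_instance

/-- `mu p = P_p` at a point of the unit interval (the clamp is the identity on `[0,1]`). [folklore] -/
theorem mu_coe (p : unitInterval) : mu (p : ℝ) = bondPercolation (zdGraph 3) p := by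
  unfold mu
  rw [Set.projIcc_val]

/-- `a_r = (r, r, 0) ∈ ℤ³`. [folklore] -/
def ptA (r : ℕ) : Site 3 := ![(r : ℤ), (r : ℤ), 0]

/-- `b_r = (r, 0, r) ∈ ℤ³`. [folklore] -/
def ptB (r : ℕ) : Site 3 := ![(r : ℤ), 0, (r : ℤ)]

/-- `A = {0 ↔ a_r in Λ_n}` (open connection inside the box `Λ_n = box 3 n`). [folklore] -/
def evA (n r : ℕ) : Set (BondConfig (Site 3)) := openConnIn (↑(box 3 n) : Set (Site 3)) 0 (ptA r)

/-- `B = {0 ↔ b_r in Λ_n}`. [folklore] -/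
def evB (n r : ℕ) : Set (BondConfig (Site 3)) := openConnIn (↑(box 3 n) : Set (Site 3)) 0 (ptB r)

/-- `C = {a_r ↔ b_r in Λ_n}`. [folklore] -/
def evC (n r : ℕ) : Set (BondConfig (Site 3)) :=
  openConnIn (↑(box 3 n) : Set (Site 3)) (ptA r) (ptB r)

/-- `T = A ∩ B = {0 ↔ a_r in Λ_n} ∩ {0 ↔ b_r in Λ_n}` (the triple connection in the box). [folklore] -/
def evT (n r : ℕ) : Set (BondConfig (Site 3)) := evA n r ∩ evB n r

/-- `E_q[N_E]`: the expected number of lattice edges of `ℤ³` pivotal for `E` under `P_q` — the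
derivative in Russo's formula (Russo 1981; Grimmett 1999 Thm 2.25). [folklore] -/
def pivInt (E : Set (BondConfig (Site 3))) (q : ℝ) : ℝ :=
  ∫ ω, ((pivotals E ω ∩ (zdGraph 3).edgeSet).encard.toNat : ℝ) ∂(mu q)

/-- `N_E(ω)`: the number of lattice edges pivotal for `E` in `ω`, as a real number (`0` if
infinite; it is finite for the box events). [folklore] -/
def pivCount (E : Set (BondConfig (Site 3))) (ω : BondConfig (Site 3)) : ℝ :=
  ((pivotals E ω ∩ (zdGraph 3).edgeSet).encard.toNat : ℝ)

/-- The flow integrand `g_{n,r}(q) = 2 E_q[N_T]/P_q(T) − E_q[N_A]/P_q(A) − E_q[N_B]/P_q(B) − E_q[N_C]/P_q(C)`,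
the `q`-derivative of `boxLogRatio n r` on `(0,1)` (by Russo's formula); after the two-of-three
identity it reads `(1/q) Σ_{P ∈ {A,B,C}} (E_q[N_P | T] − E_q[N_P | P])`, the third-point pivotal
deficit of the cards. [folklore] -/
def flowIntegrand (n r : ℕ) (q : ℝ) : ℝ :=
  2 * (pivInt (evT n r) q / (mu q).real (evT n r)) - pivInt (evA n r) q / (mu q).real (evA n r) -
    pivInt (evB n r) q / (mu q).real (evB n r) - pivInt (evC n r) q / (mu q).real (evC n r)

/-- The box log-ratio `F_{n,r}(q) = 2 log P_q(T) − log P_q(A) − log P_q(B) − log P_q(C)`. [folklore] -/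
def boxLogRatio (n r : ℕ) (q : ℝ) : ℝ :=
  2 * Real.log ((mu q).real (evT n r)) - Real.log ((mu q).real (evA n r)) -
    Real.log ((mu q).real (evB n r)) - Real.log ((mu q).real (evC n r))

/-- The infinite-volume log-ratio
`log R_r(q)² = 2 log P_q(0 ↔ a_r ↔ b_r) − log τ_q(0,a_r) − log τ_q(0,b_r) − log τ_q(a_r,b_r)`
(squared Delfino–Viti / Gladkov three-point ratio of the equilateral lattice triangle). [folklore] -/
def infLogRatio (r : ℕ) (q : ℝ) : ℝ :=
  2 * Real.log ((mu q).real (openConn 0 (ptA r) ∩ openConn 0 (ptB r))) -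
    Real.log ((mu q).real (openConn 0 (ptA r))) - Real.log ((mu q).real (openConn 0 (ptB r))) -
    Real.log ((mu q).real (openConn (ptA r) (ptB r)))

end Summit.CriticalPhenomena.PercolationContinuityZ3.Theorems.EquilateralAntiFactorisation.Flow

end
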